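import Literature.NumberTheory.Sieve.AsymptoticSieveForPrimesCoreEstimates
import Literature.NumberTheory.Sieve.AsymptoticSieveForPrimesAssemblyInputs
import HarnessLib

/-!
# Asymptotic sieve for primes under (B*): Theorem 1 with (B*) from the five term estimates (the assembly of §8 re-run in the rough regime)

Topic `Literature/NumberTheory/Sieve` (trunk T-SIEVE), second sequel of
`Literature.NumberTheory.Sieve.AsymptoticSieveForPrimesRough`. Source: J. Friedlander, H. Iwaniec,
*Asymptotic sieve for primes*, Ann. of Math. 148 (1998) 1041–1065 [FriedlanderIwaniecASP1998]
(= arXiv:math/9811186), §8 p. 1058 ("Combining (3.4), (3.5), (4.5), (5.1), (6.6), (7.2) and (8.5) we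
complete the proof of Theorem 1") and §10 pp. 1063–1065 (Theorem 3: "(B) was used solely to estimate
the sums `S₂` and `S₃` in Sections 7 and 8").

This file proves the ASSEMBLY step of the named fact
`Literature.NumberTheory.Sieve.fi_asymptotic_sieve_primes_rough_loglog` (Theorem 1 with (B) replaced by
(B*), the case of [FriedlanderIwaniecAnnals1998] Proposition 2.1 applied in the tree to
`μ²(n) #{(a,c) : a² + c⁴ = n}`):

* `fi_asymptotic_sieve_primes_rough_loglog_of_estimates` — Theorem 1 with (B*) from Brun's weights,
  the sieve-density class, `H > 0`, the three (B)-free term estimates over the core regime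
  ((4.5) `fi_asp_T_estimate_core`, (5.1) `fi_asp_Tyz_estimate_core`, (6.6) `fi_asp_S1_estimate_core`)
  and the two estimates under (B*) ((7.2) `fi_asp_S2_estimate_rough`, (8.5) `fi_asp_S3_estimate_rough`).
  The proof is the tree's `fi_asymptotic_sieve_primes_loglog_of_estimates` (`…Assembly`) run in the
  regime `FIRegimeRough` with structural exponent `θ/2` in place of `θ`: given the rough hypotheses
  for `Δ_B = x^θ` (`0 < θ < 1/3`), put `θ' = θ/2 < 1/6`, so that `Δ_B = x^{2θ'}` as `FIRegimeRough`
  demands, take weights of sifting range `x^{θ₁}` and level `x^{θ'/2}`, Vaughan parameters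
  `Y = Z = x^{-θ'/2}√D`, and combine (3.4), (3.5) with the five estimates exactly as in §8; every
  bundle-keyed tree lemma used on the way ((3.4) `fiTail_eq_decomposition`, (3.5)
  `isBigO_sum_primes_sub_tail`, `fiTail_zero`, `size_eq`) is fed the void-bilinear embedding
  `FIAsymptoticSieveHypothesesRough.withTrivialBilinear` (`…Rough`), its content being free of (B).
* `fi_asymptotic_sieve_primes_rough_loglog_of_rough_estimates` — the same with the six (B)-free
  inputs discharged (`brun_upperSieveWeights_holds`, `fi_sieve_density_admissible_holds`,
  `fi_densityConstant_pos_holds`, `fi_asp_T_estimate_core_holds`, `fi_asp_Tyz_estimate_core_holds`,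
  `fi_asp_S1_estimate_core_holds`): **Theorem 1 with (B*) follows from (7.2) and (8.5) under (B*)**,
  the two estimates that §10 re-derives from the integrated form (B̃) (the remaining sequels).

## References

* J. Friedlander, H. Iwaniec, *Asymptotic sieve for primes*, Ann. of Math. 148 (1998), 1041–1065,
  §8 p. 1058 (proof of Theorem 1) and §10 pp. 1063–1065 (Theorem 3).
  [cite: FriedlanderIwaniecASP1998, §8 p. 1058 and §10]

## Mathlib / tree search

Everything used is in the series `AsymptoticSieveForPrimes{Assembly, AssemblyInputs, Brun,
DecompositionProofs, Rough, CoreEstimates}` (`lean search 'rough_loglog_of'`: no declaration before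
this file; `fi_asymptotic_sieve_primes_rough_loglog` is the named fact of `…Rough`).
-/

noncomputable section

open Filter Asymptotics Finset
open scoped ArithmeticFunction.Moebius ArithmeticFunction.vonMangoldt ArithmeticFunction.zeta
  ArithmeticFunction.omega ArithmeticFunction.sigma

namespace Literature.NumberTheory.Sieve

open MeasureTheory
open scoped Topology

/-- **Theorem 1 with (B*) from the term estimates** (FI §8 p. 1058 run in the rough regime of §10):
Brun's weights, the sieve-density class of §6, `H > 0`, the estimates (4.5), (5.1), (6.6) over the
core regime and (7.2), (8.5) under (B*) imply `fi_asymptotic_sieve_primes_rough_loglog`. Given the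
rough hypotheses for `δ = (log x)^α`, `Δ_B = x^θ` (`0 < θ < 1/3`), the proof runs the tree's
`fi_asymptotic_sieve_primes_loglog_of_estimates` with the exponent `θ' = θ/2` (`Δ_B = x^{2θ'}`,
`θ' < 1/6`, as `FIRegimeRough` demands): weights of level `x^{θ'/2}`, `Y = Z = x^{-θ'/2}√D`, the
decomposition (3.4) integrated over `[Y, eY]²`, the small primes (3.5), and the five estimates.
[cite: FriedlanderIwaniecASP1998, §8 p. 1058 and §10 Theorem 3] -/
theorem fi_asymptotic_sieve_primes_rough_loglog_of_estimates
    (hBrun : brun_upperSieveWeights) (hdens : fi_sieve_density_admissible)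
    (hHpos : fi_densityConstant_pos) (hT : fi_asp_T_estimate_core) (hTyz : fi_asp_Tyz_estimate_core)
    (hS1 : fi_asp_S1_estimate_core) (hS2 : fi_asp_S2_estimate_rough)
    (hS3 : fi_asp_S3_estimate_rough) : fi_asymptotic_sieve_primes_rough_loglog := by
  intro A D P α θ H hα hθ hθ3 hhypR hH
  -- the structural exponent `θ' = θ/2`: `Δ_B = x^θ = x^{2θ'}`, `θ' < 1/6`
  set θr : ℝ := θ / 2 with hθrdef
  have hθr : 0 < θr := by rw [hθrdef]; positivity
  have hθr3 : θr < 1 / 3 := by rw [hθrdef]; linarith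
  have hθr6 : θr < 1 / 6 := by rw [hθrdef]; linarith
  have hcast : (fun x : ℝ => x ^ (2 * θr)) = fun x : ℝ => x ^ θ := by
    funext x
    rw [hθrdef, mul_div_cancel₀ θ two_ne_zero]
  have hhypR' : A.FIAsymptoticSieveHypothesesRough D (fun x => Real.log x ^ α)
      (fun x => x ^ (2 * θr)) P := by
    rw [hcast]; exact hhypR
  -- the literal hypotheses of Theorem 1 with void bilinear parameters (content free of (B))
  have hhyp := hhypR.withTrivialBilinear
  classical
  -- clauses of the hypotheses
  have h18 := hhyp.2.2.2.1
  have h19 := hhyp.2.2.2.2.1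
  have hR1 : ∀ᶠ x : ℝ in atTop, x ^ (2 / 3 : ℝ) < D x ∧ D x < x :=
    hhyp.2.2.2.2.2.2.1.mono fun x hx => ⟨hx.1, hx.2.1⟩
  -- `H > 0`
  have hH0 : 0 < H := hHpos A.density A.density_mult h18 h19 H hH
  -- the sieve-density class and Brun's weights
  obtain ⟨κ, A₁, A₂, hκ, hA₁, hclass⟩ := hdens A.density A.density_mult h18
  obtain ⟨c, C, hc, hC, hw⟩ := hBrun κ A₁ A₂ hκ hA₁
  set c' : ℝ := max c 1 with hc'def
  have hc'1 : 1 ≤ c' := le_max_right _ _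
  have hcc' : c ≤ c' := le_max_left _ _
  have hc'0 : 0 < c' := by linarith
  set θ₁ : ℝ := θr / (2 * c') with hθ₁def
  have hθ₁pos : 0 < θ₁ := by positivity
  have hθ₁c' : θ₁ * c' = θr / 2 := by rw [hθ₁def]; field_simp
  have hθ₁le : θ₁ ≤ θr / 2 := by
    rw [← hθ₁c']; exact le_mul_of_one_le_right hθ₁pos.le hc'1
  have hθ₁c : θ₁ * c ≤ θr / 2 := by
    rw [← hθ₁c']; exact mul_le_mul_of_nonneg_left hcc' hθ₁pos.le
  have hθ₁13 : θ₁ ≤ 1 / 3 - θr / 2 := by linarith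
  -- weights, as a function of `x`
  let lam : ℝ → ℕ → ℤ := fun x =>
    if hx : 2 ≤ x ^ θ₁ then Classical.choose (hw (x ^ θ₁) hx) else fun _ => 0
  have hlam_eq : ∀ (x : ℝ) (hx : 2 ≤ x ^ θ₁), lam x = Classical.choose (hw (x ^ θ₁) hx) :=
    fun x hx => dif_pos hx
  have hspec := fun (x : ℝ) (hx : 2 ≤ x ^ θ₁) => Classical.choose_spec (hw (x ^ θ₁) hx)
  have hev2 : ∀ᶠ x : ℝ in atTop, 2 ≤ x ^ θ₁ := (tendsto_rpow_atTop hθ₁pos).eventually_ge_atTop 2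
  have hweights : ∀ᶠ x : ℝ in atTop, IsUpperSieveWeights (x ^ θ₁) (x ^ (θr / 2)) (lam x) := by
    filter_upwards [hev2, eventually_ge_atTop (1 : ℝ)] with x hx hx1
    rw [hlam_eq x hx]
    refine (hspec x hx).1.mono_level ?_
    rw [← Real.rpow_mul (by linarith)]
    exact Real.rpow_le_rpow_of_exponent_le hx1 hθ₁c
  have hreg : FIRegimeRough A D α θr θ₁ lam P := ⟨hα, hθ₁pos, hθ₁le, hθr6, hhypR', hweights⟩
  -- Brun's bound for FI's densities `w_ε`
  have hBB : ∃ C : ℝ, ∀ᶠ x : ℝ in atTop, ∀ ε : ℝ, 0 < ε → ε ≤ 1 →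
      ∑ d ∈ (primesProdBelow (x ^ θ₁)).divisors,
          (lam x d : ℝ) * ∏ p ∈ d.primeFactors, fiSieveDensity A.density ε p ≤
        C * ∏ p ∈ Nat.primesBelow ⌈x ^ θ₁⌉₊, (1 - fiSieveDensity A.density ε p) := by
    refine ⟨C, ?_⟩
    filter_upwards [hev2] with x hx ε hε hε1
    rw [hlam_eq x hx]
    obtain ⟨hw1, hw2⟩ := hclass ε hε hε1
    exact (hspec x hx).2 _ (fun p hp _ => hw1 p hp) (fun u v hu huv _ => hw2 u v hu huv)
  -- the five estimates
  obtain ⟨KT, hKT⟩ := hT A D _ _ α θr θ₁ lam H hreg.toCore hH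
  obtain ⟨KTyz, hKTyz⟩ := hTyz A D _ _ α θr θ₁ lam hreg.toCore
  obtain ⟨K1, hK1⟩ := hS1 A D _ _ α θr θ₁ lam hreg.toCore hBB
  obtain ⟨K2, hK2⟩ := hS2 A D α θr θ₁ lam P hreg
  obtain ⟨K3, hK3⟩ := hS3 A D α θr θ₁ lam P hreg
  -- the small primes (3.5)
  have hZ' : ∀ᶠ x : ℝ in atTop, Real.exp 1 * fiY D θr x ≤ Real.sqrt x :=
    eventually_exp_mul_fiY_le_sqrt hθr hR1
  have hZ0 : ∀ᶠ x : ℝ in atTop, 0 ≤ Real.exp 1 * fiY D θr x := by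
    filter_upwards [hR1, eventually_ge_atTop (1 : ℝ)] with x hx hx1
    exact mul_nonneg (Real.exp_pos 1).le (fiY_pos_and_ge hx1 hx.1 hθ₁13).1.le
  obtain ⟨K0, hK0⟩ := (hhyp.isBigO_sum_primes_sub_tail hZ0 hZ').bound
  -- growth of `x^{θr/2}` against `(log x)^α`
  have hlog8 : ∀ᶠ x : ℝ in atTop, 8 * Real.log x ^ α ≤ x ^ (θr / 2) := by
    have := (isLittleO_log_rpow_rpow_atTop α (half_pos hθr)).def (by norm_num : (0 : ℝ) < 1 / 8)
    filter_upwards [this, eventually_gt_atTop 1] with x hx hx1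
    rw [Real.norm_of_nonneg (Real.rpow_nonneg (Real.log_nonneg hx1.le) α),
      Real.norm_of_nonneg (Real.rpow_nonneg (by linarith) _)] at hx
    linarith
  -- constants
  set e : ℝ := Real.exp 1 with he_def
  have he1 : 1 < e := by have := Real.exp_one_gt_d9; simp only [he_def]; linarith
  set Ktot : ℝ := |K0| + (e - 1) ^ 2 * (|KT| + |KTyz| + |K1|) + (e - 1) * (|K2| + |K3|) with hKtot
  refine IsBigO.of_bound (Ktot / H) ?_
  filter_upwards [hweights, hKT, hKTyz, hK1, hK2, hK3, hK0, hR1, hlog8,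
    eventually_ge_atTop (Real.exp (Real.exp 1))] with x hwx hTx hTyzx h1x h2x h3x h0x hR1x hlog8x hxee
  -- basic inequalities at `x`
  have hxe : Real.exp 1 ≤ x := le_trans (Real.exp_le_exp.mpr he1.le) hxee
  have hx1 : 1 < x := lt_of_lt_of_le (by linarith) hxe
  have hx0 : 0 < x := by linarith
  have hlogx : 1 ≤ Real.log x := by
    rw [← Real.log_exp 1]; exact Real.log_le_log (Real.exp_pos 1) hxe
  have hlogx0 : 0 < Real.log x := by linarith
  have hllx : 1 ≤ Real.log (Real.log x) := by
    rw [← Real.log_exp 1]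
    refine Real.log_le_log (Real.exp_pos 1) ?_
    rw [← Real.log_exp (Real.exp 1)]
    exact Real.log_le_log (Real.exp_pos _) hxee
  have hA0 : 0 ≤ A.size x := by rw [hhyp.size_eq]; exact A.congrSum_nonneg 1 x
  set Y : ℝ := fiY D θr x with hYdef
  obtain ⟨hY0, hYθ₁⟩ := fiY_pos_and_ge hx1.le hR1x.1 hθ₁13 (D := D)
  have hYe : Y ≤ e * Y := by nlinarith
  -- the splitting parameter `s`
  have hD0 : 0 < D x := lt_trans (Real.rpow_pos_of_pos hx0 _) hR1x.1
  have hSL : 1 ≤ fiSLow D α θr x := by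
    refine le_trans ?_ (fiSLow_ge hx1 hD0 hR1x.2)
    rw [one_le_div (by positivity)]
    exact hlog8x
  obtain ⟨s, hs, hs1⟩ := exists_isFISplit hSL
  obtain ⟨B, hB⟩ := A.exists_bound_fiS2_fiS3 (lam x) x
  -- integrability of `Φ(z) = (S♯(x, z) - H A(x)) / z`
  have hint := A.intervalIntegrable_fiTail_div x hY0 hYe
  have hinv : IntervalIntegrable (fun z : ℝ => z⁻¹) volume Y (e * Y) := by
    refine intervalIntegral.intervalIntegrable_inv (fun z hz => ?_) continuousOn_id
    rw [Set.uIcc_of_le hYe] at hz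
    exact (hY0.trans_le hz.1).ne'
  have hcI : IntervalIntegrable (fun z : ℝ => H * A.size x / z) volume Y (e * Y) := by
    simpa [div_eq_mul_inv] using hinv.const_mul (H * A.size x)
  have hΦ : IntervalIntegrable (fun z => (A.fiTail x z - H * A.size x) / z) volume Y (e * Y) := by
    have : (fun z => (A.fiTail x z - H * A.size x) / z) =
        fun z => A.fiTail x z / z - H * A.size x / z := by
      funext z; ring
    rw [this]
    exact hint.sub hcI
  -- the pointwise decomposition (3.4)
  have hid : ∀ y ∈ Set.Icc Y (e * Y), ∀ z ∈ Set.Icc Y (e * Y),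
      A.fiTail x z - H * A.size x = (A.fiT (lam x) x y - H * A.size x) - A.fiTyz (lam x) x y z
        + A.fiS1 (lam x) s x y z + A.fiS2 (lam x) s x y z + A.fiS3 (lam x) s x y z := by
    intro y hy z hz
    have := hhyp.fiTail_eq_decomposition hwx (x := x) (hY0.le.trans hy.1) (hY0.le.trans hz.1) hs1
      (hYθ₁.trans hz.1)
    rw [this]
    ring
  -- the averaged bound
  have key := abs_logAvg_le_of_decomposition (Y := Y) (Z := Y)
    (E₁ := KT * A.size x / Real.log x ^ 2) (E₂ := KTyz * A.size x / Real.log x ^ 2)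
    (E₃ := K1 * A.size x * Real.log (Real.log x) / Real.log x)
    (E₄ := K2 * A.size x / Real.log x) (E₅ := K3 * A.size x / Real.log x) (B := B)
    (Φ := fun z => A.fiTail x z - H * A.size x)
    (T₁ := fun y => A.fiT (lam x) x y - H * A.size x)
    (T₂ := fun y z => A.fiTyz (lam x) x y z) (P₁ := fun y z => A.fiS1 (lam x) s x y z)
    (P₂ := fun y z => A.fiS2 (lam x) s x y z) (P₃ := fun y z => A.fiS3 (lam x) s x y z)
    hY0 hY0 hΦ (A.measurable_fiS2 (lam x) s x) (A.measurable_fiS3 (lam x) s x)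
    (fun y _ z _ => (hB s y z).1) (fun y _ z _ => (hB s y z).2) hid
    (fun y hy => hTx y hy.1 hy.2) (fun y hy z hz => hTyzx y hy.1 hy.2 z hz.1 hz.2)
    (fun y hy z hz => h1x s hs y hy.1 hy.2 z hz.1 hz.2)
    (fun z hz => by simpa [SieveSequence.fiS2Y, SieveSequence.logAvg] using h2x s hs z hz.1 hz.2)
    (fun y hy => by simpa [SieveSequence.fiS3Z, SieveSequence.logAvg] using h3x s hs y hy.1 hy.2)
  -- `∫ (S♯ - HA)/z = S(x, Y) - H A(x)`
  have hone := integral_inv_Ioc_exp_mul hY0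
  have hsm : ∫ z in Y..(e * Y), (A.fiTail x z - H * A.size x) / z =
      A.fiSmooth x Y - H * A.size x := by
    have : (fun z => (A.fiTail x z - H * A.size x) / z) =
        fun z => A.fiTail x z / z - H * A.size x / z := by
      funext z; ring
    rw [this, intervalIntegral.integral_sub hint hcI]
    simp_rw [div_eq_mul_inv (H * A.size x)]
    rw [intervalIntegral.integral_const_mul, hone, mul_one]
    rfl
  rw [hsm] at key
  -- the small primes: `|S(x) - S(x, Y)| ≤ S(x) - S♯(x, eY) ≤ |K0| A(x)/log x`
  obtain ⟨hlo, hhi⟩ := A.fiTail_le_fiSmooth_le hY0 (x := x)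
  have hS : ∑ p ∈ Nat.primesLE ⌊x⌋₊, A.a p * Real.log p = A.fiTail x 0 := (hhyp.fiTail_zero x).symm
  have htail0 : A.fiTail x Y ≤ A.fiTail x 0 := A.fiTail_antitone x hY0.le
  have h0x' : A.fiTail x 0 - A.fiTail x (e * Y) ≤ |K0| * (A.size x / Real.log x) := by
    have h := h0x
    rw [hS, Real.norm_eq_abs, Real.norm_eq_abs, abs_of_nonneg (div_nonneg hA0 hlogx0.le)] at h
    calc A.fiTail x 0 - A.fiTail x (e * Y) ≤ |A.fiTail x 0 - A.fiTail x (e * Y)| := le_abs_self _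
      _ ≤ K0 * (A.size x / Real.log x) := h
      _ ≤ |K0| * (A.size x / Real.log x) :=
          mul_le_mul_of_nonneg_right (le_abs_self _) (div_nonneg hA0 hlogx0.le)
  have hpart1 : |A.fiTail x 0 - A.fiSmooth x Y| ≤ |K0| * (A.size x / Real.log x) := by
    rw [abs_of_nonneg (by linarith)]
    linarith
  -- combine
  rw [hS, Real.norm_eq_abs]
  have hmain : |A.fiTail x 0 - H * A.size x| ≤
      |K0| * (A.size x / Real.log x) +
      ((e - 1) ^ 2 * (KT * A.size x / Real.log x ^ 2 + KTyz * A.size x / Real.log x ^ 2 +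
          K1 * A.size x * Real.log (Real.log x) / Real.log x) +
        (e - 1) * (K2 * A.size x / Real.log x + K3 * A.size x / Real.log x)) := by
    calc |A.fiTail x 0 - H * A.size x|
        = |(A.fiTail x 0 - A.fiSmooth x Y) + (A.fiSmooth x Y - H * A.size x)| := by ring_nf
      _ ≤ |A.fiTail x 0 - A.fiSmooth x Y| + |A.fiSmooth x Y - H * A.size x| := abs_add_le _ _
      _ ≤ _ := add_le_add hpart1 key
  -- compare with `Ktot * A(x) log log x / log x`
  set L := Real.log x with hL
  set LL := Real.log (Real.log x) with hLL
  set Q : ℝ := A.size x * LL / L with hQ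
  have hQ0 : 0 ≤ Q := by positivity
  have hq1 : A.size x / L ≤ Q := by
    rw [hQ, div_le_div_iff_of_pos_right hlogx0]
    exact le_mul_of_one_le_right hA0 hllx
  have hLL2 : L ≤ L ^ 2 := by rw [sq]; exact le_mul_of_one_le_right hlogx0.le hlogx
  have hq2 : A.size x / L ^ 2 ≤ Q :=
    le_trans (div_le_div_of_nonneg_left hA0 hlogx0 hLL2) hq1
  have hAL2 : 0 ≤ A.size x / L ^ 2 := by positivity
  have hAL : 0 ≤ A.size x / L := by positivity
  have t0 : |K0| * (A.size x / L) ≤ |K0| * Q := mul_le_mul_of_nonneg_left hq1 (abs_nonneg _)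
  have t1 : KT * A.size x / L ^ 2 ≤ |KT| * Q := by
    rw [mul_div_assoc]
    exact (mul_le_mul_of_nonneg_right (le_abs_self _) hAL2).trans
      (mul_le_mul_of_nonneg_left hq2 (abs_nonneg _))
  have t2 : KTyz * A.size x / L ^ 2 ≤ |KTyz| * Q := by
    rw [mul_div_assoc]
    exact (mul_le_mul_of_nonneg_right (le_abs_self _) hAL2).trans
      (mul_le_mul_of_nonneg_left hq2 (abs_nonneg _))
  have t3 : K1 * A.size x * LL / L ≤ |K1| * Q := by
    rw [show K1 * A.size x * LL / L = K1 * Q by rw [hQ]; ring]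
    exact mul_le_mul_of_nonneg_right (le_abs_self _) hQ0
  have t4 : K2 * A.size x / L ≤ |K2| * Q := by
    rw [mul_div_assoc]
    exact (mul_le_mul_of_nonneg_right (le_abs_self _) hAL).trans
      (mul_le_mul_of_nonneg_left hq1 (abs_nonneg _))
  have t5 : K3 * A.size x / L ≤ |K3| * Q := by
    rw [mul_div_assoc]
    exact (mul_le_mul_of_nonneg_right (le_abs_self _) hAL).trans
      (mul_le_mul_of_nonneg_left hq1 (abs_nonneg _))
  have he0 : 0 ≤ e - 1 := by linarith
  have u1 : (e - 1) ^ 2 * (KT * A.size x / L ^ 2 + KTyz * A.size x / L ^ 2 +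
      K1 * A.size x * LL / L) ≤ (e - 1) ^ 2 * ((|KT| + |KTyz| + |K1|) * Q) :=
    mul_le_mul_of_nonneg_left (by linarith) (sq_nonneg _)
  have u2 : (e - 1) * (K2 * A.size x / L + K3 * A.size x / L) ≤ (e - 1) * ((|K2| + |K3|) * Q) :=
    mul_le_mul_of_nonneg_left (by linarith) he0
  have hfin : |A.fiTail x 0 - H * A.size x| ≤ Ktot * Q := by
    refine hmain.trans ?_
    calc _ ≤ |K0| * Q + ((e - 1) ^ 2 * ((|KT| + |KTyz| + |K1|) * Q)
            + (e - 1) * ((|K2| + |K3|) * Q)) := add_le_add t0 (add_le_add u1 u2)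
      _ = Ktot * Q := by rw [hKtot]; ring
  refine hfin.trans (le_of_eq ?_)
  rw [Real.norm_of_nonneg (by positivity), hQ]
  field_simp

/-- **Theorem 1 with (B*) from (7.2) and (8.5) under (B*)**: with Brun's weights, the sieve-density
class, `H > 0` and the three (B)-free estimates (4.5), (5.1), (6.6) all theorems of the tree
(`brun_upperSieveWeights_holds`, `fi_sieve_density_admissible_holds`, `fi_densityConstant_pos_holds`,
`fi_asp_T_estimate_core_holds`, `fi_asp_Tyz_estimate_core_holds`, `fi_asp_S1_estimate_core_holds`),
the named fact `fi_asymptotic_sieve_primes_rough_loglog` follows from the two estimates that FI §10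
re-derives from the integrated bilinear bound (B̃): `fi_asp_S2_estimate_rough` (7.2) and
`fi_asp_S3_estimate_rough` (8.5). [cite: FriedlanderIwaniecASP1998, §10 Theorem 3] -/
theorem fi_asymptotic_sieve_primes_rough_loglog_of_rough_estimates (hS2 : fi_asp_S2_estimate_rough)
    (hS3 : fi_asp_S3_estimate_rough) : fi_asymptotic_sieve_primes_rough_loglog :=
  fi_asymptotic_sieve_primes_rough_loglog_of_estimates brun_upperSieveWeights_holds
    fi_sieve_density_admissible_holds fi_densityConstant_pos_holds fi_asp_T_estimate_core_holds
    fi_asp_Tyz_estimate_core_holds fi_asp_S1_estimate_core_holds hS2 hS3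

end Literature.NumberTheory.Sieve
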